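import Literature.Probability.RandomPlanarGeometry.SAWIrreducibleBridgeTwoSlack
import Literature.Probability.RandomPlanarGeometry.SAWPulledLargeForceExpansionZdThirdOrder
import HarnessLib

/-!
# The two-slack layer of the pulled large-force expansion on `ℤ^{d+1}`: the bridges as table-driven families

Topic `Literature/Probability/RandomPlanarGeometry` (continues `SAWIrreducibleBridgeTwoSlack.lean` — the structure theorem: an
irreducible bridge of span `A ≥ 2` and length `3A + 2` has exactly four transverse steps and its height word is the reduced staple
word or a reduced bump word read at the reduced positions — and the cost grading `costCoeffZd d c n = N_{c,n}(ℤ^{d+1})` of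
`SAWPulledLargeForceExpansionZd.lean`).

THIS FILE turns the structure theorem into a BIJECTION. A member of the layer `N_{2A+2,3A+2}(ℤ^{d+1})` is the table-driven walk
`flatWalk d n R f u : t ↦ R(j(t))·e₀ + (u₁ + ⋯ + u_{c(t)})`, where `f = (a,b,c,e)` are its four flat times, `c(t) = #{flats < t}`,
`j(t) = t − c(t)` the reduced position, `R` the reduced word (`stapleR A`, with two of the flats at the reduced positions `A`, `2A−1`;
or `bumpR A P` with `f = (P, 2P, 2P+A, P+2A+1)`) and `u` the four transverse unit steps. Conversely every such walk that is
self-avoiding is an irreducible bridge of the layer (bridge and irreducibility are properties of the reduced word alone). Hence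
★ `costCoeffZd d (2A+2) (3A+2) = Σ_{f ∈ stapleFlats A} #{u : flatWalk … self-avoiding} + Σ_{P=2}^{A−1} #{u : …}` — the count is
reduced to the FIBRES (numbers of admissible transverse 4-tuples per height word), which the sequel evaluates (four fibre
polynomials `κ, α, β, γ`; lane FINDING (12)/(13)).

## Contents (namespace `Literature.Probability.RandomPlanarGeometry.SAW.Zd.TwoSlack`)
`cnt`, `IsFlats`, `Steps`, `psum4`, `flatWalk`, `IsRedWord` (+ instances for `stapleR`, `bumpR`), `stapleFlats`, `bumpFlats`, `admS`, `admB`;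
generic `flatWalk_adj/_isBridge/_irreducible/_mem_filter/_injective/_flat_iff`; the converse `exists_eq_flatWalk_*`;
★ `costCoeffZd_two_mul_add_two_eq_sum_card`. Lane «pcv-sawmu» (a-p3 g17, 2026-08-25).
[cite: MadrasSlade1993, §4.2, remark after Theorem 4.2.4 (p. 94)] [cite: DuminilCopinHammond2013, §2.2]
-/

noncomputable section

open Finset Literature.Probability.LatticeModels SimpleGraph
open scoped BigOperators
open Literature.Probability.RandomPlanarGeometry.SAW

namespace Literature.Probability.RandomPlanarGeometry.SAW.Zd

namespace TwoSlack

/-! ### Flat times and the counting function -/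

/-- The number of flats strictly before time `t`, for the flat times `f = (a, b, c, e)`. [cite: MadrasSlade1993, §4.2, remark after Theorem 4.2.4 (p. 94)] -/
def cnt (f : ℕ × ℕ × ℕ × ℕ) (t : ℕ) : ℕ :=
  (if f.1 < t then 1 else 0) + (if f.2.1 < t then 1 else 0) + (if f.2.2.1 < t then 1 else 0) + (if f.2.2.2 < t then 1 else 0)

/-- Admissible flat times of an `n`-step walk: `1 ≤ a < b < c < e < n`. [cite: MadrasSlade1993, §4.2, remark after Theorem 4.2.4 (p. 94)] -/
def IsFlats (n : ℕ) (f : ℕ × ℕ × ℕ × ℕ) : Prop := 1 ≤ f.1 ∧ f.1 < f.2.1 ∧ f.2.1 < f.2.2.1 ∧ f.2.2.1 < f.2.2.2 ∧ f.2.2.2 < n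

/-- `IsFlats` is decidable. [cite: MadrasSlade1993, §4.2, remark after Theorem 4.2.4 (p. 94)] -/
instance (n : ℕ) : DecidablePred (IsFlats n) := fun f => by unfold IsFlats; infer_instance

/-- The values of `cnt` on the five segments. [cite: MadrasSlade1993, §4.2, remark after Theorem 4.2.4 (p. 94)] -/
theorem cnt_eq {n : ℕ} {f : ℕ × ℕ × ℕ × ℕ} (hf : IsFlats n f) (t : ℕ) :
    cnt f t = if t ≤ f.1 then 0 else if t ≤ f.2.1 then 1 else if t ≤ f.2.2.1 then 2 else if t ≤ f.2.2.2 then 3 else 4 := by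
  obtain ⟨h1, h2, h3, h4, h5⟩ := hf
  simp only [cnt]; split_ifs <;> omega

/-- One time step adds the indicator of a flat. [cite: MadrasSlade1993, §4.2, remark after Theorem 4.2.4 (p. 94)] -/
theorem cnt_succ {n : ℕ} {f : ℕ × ℕ × ℕ × ℕ} (hf : IsFlats n f) (t : ℕ) :
    cnt f (t + 1) = cnt f t + if (t = f.1 ∨ t = f.2.1 ∨ t = f.2.2.1 ∨ t = f.2.2.2) then 1 else 0 := by
  rw [cnt_eq hf (t + 1), cnt_eq hf t]
  obtain ⟨h1, h2, h3, h4, h5⟩ := hf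
  split_ifs <;> omega

/-- `cnt f 0 = 0`. [cite: MadrasSlade1993, §4.2, remark after Theorem 4.2.4 (p. 94)] -/
theorem cnt_zero (f : ℕ × ℕ × ℕ × ℕ) : cnt f 0 = 0 := by simp [cnt]

/-- `cnt ≤ 4`. [cite: MadrasSlade1993, §4.2, remark after Theorem 4.2.4 (p. 94)] -/
theorem cnt_le_four (f : ℕ × ℕ × ℕ × ℕ) (t : ℕ) : cnt f t ≤ 4 := by
  simp only [cnt]; split_ifs <;> omega

/-- All four flats are before `n`. [cite: MadrasSlade1993, §4.2, remark after Theorem 4.2.4 (p. 94)] -/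
theorem cnt_eq_four {n : ℕ} {f : ℕ × ℕ × ℕ × ℕ} (hf : IsFlats n f) {t : ℕ} (ht : n ≤ t) : cnt f t = 4 := by
  obtain ⟨h1, h2, h3, h4, h5⟩ := hf
  simp only [cnt]
  rw [if_pos (by omega), if_pos (by omega), if_pos (by omega), if_pos (by omega)]

/-- `cnt f t ≤ t − 1` for `t ≥ 1` (the first flat is at a time `≥ 1`), so the reduced position `t − cnt f t` is `≥ 1`. [cite: MadrasSlade1993, §4.2, remark after Theorem 4.2.4 (p. 94)] -/
theorem cnt_lt {n : ℕ} {f : ℕ × ℕ × ℕ × ℕ} (hf : IsFlats n f) {t : ℕ} (ht : 1 ≤ t) : cnt f t + 1 ≤ t := by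
  have := cnt_eq hf t
  obtain ⟨h1, h2, h3, h4, h5⟩ := hf
  split_ifs at this <;> omega

/-- The values of `cnt` at the four flat times. [cite: MadrasSlade1993, §4.2, remark after Theorem 4.2.4 (p. 94)] -/
theorem cnt_at_flats {n : ℕ} {f : ℕ × ℕ × ℕ × ℕ} (hf : IsFlats n f) :
    cnt f f.1 = 0 ∧ cnt f f.2.1 = 1 ∧ cnt f f.2.2.1 = 2 ∧ cnt f f.2.2.2 = 3 := by
  have e1 := cnt_eq hf f.1; have e2 := cnt_eq hf f.2.1; have e3 := cnt_eq hf f.2.2.1; have e4 := cnt_eq hf f.2.2.2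
  obtain ⟨h1, h2, h3, h4, h5⟩ := hf
  refine ⟨?_, ?_, ?_, ?_⟩
  · rw [e1, if_pos le_rfl]
  · rw [e2, if_neg (by omega), if_pos le_rfl]
  · rw [e3, if_neg (by omega), if_neg (by omega), if_pos le_rfl]
  · rw [e4, if_neg (by omega), if_neg (by omega), if_neg (by omega), if_pos le_rfl]

/-- `cnt ≤ 3` at a flat time. [cite: MadrasSlade1993, §4.2, remark after Theorem 4.2.4 (p. 94)] -/
theorem cnt_le_three_of_flat {n : ℕ} {f : ℕ × ℕ × ℕ × ℕ} (hf : IsFlats n f) {t : ℕ}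
    (hmem : t = f.1 ∨ t = f.2.1 ∨ t = f.2.2.1 ∨ t = f.2.2.2) : cnt f t ≤ 3 := by
  obtain ⟨c0, c1, c2, c3⟩ := cnt_at_flats hf
  rcases hmem with rfl | rfl | rfl | rfl <;> omega

/-! ### Transverse data and the table-driven walks -/

/-- Four transverse unit steps `(u₁, u₂, u₃, u₄)`, each `±e_{j+1}` coded by `Fin d × Bool`. [cite: MadrasSlade1993, Definition 1.2.4] -/
abbrev Steps (d : ℕ) := (Fin d × Bool) × (Fin d × Bool) × (Fin d × Bool) × (Fin d × Bool)

/-- The partial sums `0, u₁, u₁+u₂, u₁+u₂+u₃, u₁+u₂+u₃+u₄` (frozen from `4`). [cite: MadrasSlade1993, Definition 1.2.4] -/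
def psum4 (d : ℕ) (u : Steps d) : ℕ → Site (d + 1)
  | 0 => 0
  | 1 => twoStepV d u.1
  | 2 => twoStepV d u.1 + twoStepV d u.2.1
  | 3 => twoStepV d u.1 + twoStepV d u.2.1 + twoStepV d u.2.2.1
  | _ + 4 => twoStepV d u.1 + twoStepV d u.2.1 + twoStepV d u.2.2.1 + twoStepV d u.2.2.2

/-- `psum4` has no `e₀`-component. [cite: MadrasSlade1993, Definition 1.2.4] -/
@[simp] theorem psum4_apply_zero (d : ℕ) (u : Steps d) : ∀ m, psum4 d u m 0 = 0
  | 0 => rfl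
  | 1 => by simp [psum4]
  | 2 => by simp [psum4]
  | 3 => by simp [psum4]
  | _ + 4 => by simp [psum4]

/-- The `m`-th transverse step (`m = 0,1,2,3`). [cite: MadrasSlade1993, Definition 1.2.4] -/
def nth (d : ℕ) (u : Steps d) (m : ℕ) : Fin d × Bool :=
  if m = 0 then u.1 else if m = 1 then u.2.1 else if m = 2 then u.2.2.1 else u.2.2.2

/-- The four values of `nth`. [cite: MadrasSlade1993, Definition 1.2.4] -/
theorem nth_vals (d : ℕ) (u : Steps d) : nth d u 0 = u.1 ∧ nth d u 1 = u.2.1 ∧ nth d u 2 = u.2.2.1 ∧ nth d u 3 = u.2.2.2 := by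
  simp [nth]

/-- `psum4 (m+1) = psum4 m + u_{m+1}` for `m ≤ 3`. [cite: MadrasSlade1993, Definition 1.2.4] -/
theorem psum4_succ (d : ℕ) (u : Steps d) {m : ℕ} (hm : m ≤ 3) : psum4 d u (m + 1) = psum4 d u m + twoStepV d (nth d u m) := by
  interval_cases m <;> simp [psum4, nth]

/-- `psum4` is frozen from `4`. [cite: MadrasSlade1993, Definition 1.2.4] -/
theorem psum4_of_four_le (d : ℕ) (u : Steps d) {m : ℕ} (hm : 4 ≤ m) : psum4 d u m = psum4 d u 4 := by
  obtain ⟨k, rfl⟩ : ∃ k, m = k + 4 := ⟨m - 4, by omega⟩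
  rfl

/-- The table-driven walk: reduced word `R`, length `n`, flat times `f`, transverse steps `u`; frozen from time `n`.
[cite: MadrasSlade1993, §4.2, remark after Theorem 4.2.4 (p. 94)] -/
def flatWalk (d n : ℕ) (R : ℕ → ℕ) (f : ℕ × ℕ × ℕ × ℕ) (u : Steps d) (t : ℕ) : Site (d + 1) :=
  Pi.single 0 (R (min t n - cnt f (min t n)) : ℤ) + psum4 d u (cnt f (min t n))

/-- Heights along `flatWalk`. [cite: MadrasSlade1993, §4.2, remark after Theorem 4.2.4 (p. 94)] -/
theorem flatWalk_apply_zero (d n : ℕ) (R : ℕ → ℕ) (f) (u : Steps d) (t : ℕ) :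
    flatWalk d n R f u t 0 = R (min t n - cnt f (min t n)) := by
  simp [flatWalk]

/-- `flatWalk` is frozen from `n`. [cite: MadrasSlade1993, §4.2, remark after Theorem 4.2.4 (p. 94)] -/
theorem flatWalk_of_le (d n : ℕ) (R : ℕ → ℕ) (f) (u : Steps d) {t : ℕ} (ht : n ≤ t) : flatWalk d n R f u t = flatWalk d n R f u n := by
  simp only [flatWalk, min_eq_right ht, min_self]

/-- The admissible reduced words: unit steps, heights in `[1, A]` after the start, end `A`, and no «reduced renewal position».
[cite: DuminilCopinHammond2013, §2.2] -/
structure IsRedWord (A L : ℕ) (R : ℕ → ℕ) : Prop where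
  zero : R 0 = 0
  step : ∀ j, j < L → R (j + 1) = R j + 1 ∨ R j = R (j + 1) + 1
  range : ∀ j, 1 ≤ j → j ≤ L → 1 ≤ R j ∧ R j ≤ A
  last : R L = A
  noRenewal : ∀ j, 1 ≤ j → j < L → (∃ i, i ≤ j ∧ R j < R i) ∨ (∃ i, j < i ∧ i ≤ L ∧ R i ≤ R j)

/-- `x ↦ x + e₀` is a lattice step. [cite: MadrasSlade1993, Definition 1.2.4] -/
private theorem adj_add_e0_tw (d : ℕ) (x : Site (d + 1)) : (zdGraph (d + 1)).Adj x (x + Pi.single 0 1) := by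
  rw [zdGraph_adj_iff]; exact ⟨0, Or.inl rfl⟩

section generic

variable {d n A L : ℕ} {R : ℕ → ℕ} {f : ℕ × ℕ × ℕ × ℕ}

/-- The reduced position is non-decreasing and grows by at most one per step. [cite: MadrasSlade1993, §4.2, remark after Theorem 4.2.4 (p. 94)] -/
theorem redPos_succ (hf : IsFlats n f) (t : ℕ) :
    (t + 1 - cnt f (t + 1) = t - cnt f t ∧ (t = f.1 ∨ t = f.2.1 ∨ t = f.2.2.1 ∨ t = f.2.2.2)) ∨
      (t + 1 - cnt f (t + 1) = t - cnt f t + 1 ∧ ¬ (t = f.1 ∨ t = f.2.1 ∨ t = f.2.2.1 ∨ t = f.2.2.2)) := by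
  have hs := cnt_succ hf t
  have hle : cnt f t ≤ t := by
    rcases Nat.eq_zero_or_pos t with rfl | ht
    · rw [cnt_zero]
    · have := cnt_lt hf ht; omega
  by_cases h : t = f.1 ∨ t = f.2.1 ∨ t = f.2.2.1 ∨ t = f.2.2.2
  · rw [if_pos h] at hs; left; exact ⟨by omega, h⟩
  · rw [if_neg h] at hs; right; exact ⟨by omega, h⟩

/-- Reduced positions are `≤ L` up to time `n = L + 4`, `< L` before a vertical step. [cite: MadrasSlade1993, §4.2, remark after Theorem 4.2.4 (p. 94)] -/
theorem redPos_le (hf : IsFlats n f) (hn : n = L + 4) {t : ℕ} (ht : t ≤ n) : t - cnt f t ≤ L := by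
  have := cnt_eq hf t
  obtain ⟨h1, h2, h3, h4, h5⟩ := hf
  split_ifs at this <;> omega

/-- Discrete intermediate values of the reduced position: every `i` between `j(s)` and `j(t)` is `j(r)` for some `r ∈ [s, t]`. [cite: MadrasSlade1993, §4.2, remark after Theorem 4.2.4 (p. 94)] -/
theorem exists_redPos_eq (hf : IsFlats n f) {s : ℕ} : ∀ t, s ≤ t → ∀ i, s - cnt f s ≤ i → i ≤ t - cnt f t →
    ∃ r, s ≤ r ∧ r ≤ t ∧ r - cnt f r = i := by
  intro t
  induction t with
  | zero =>
    intro hs i hi1 hi2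
    have : s = 0 := by omega
    subst this
    exact ⟨0, le_rfl, le_rfl, by rw [cnt_zero] at hi2 ⊢; omega⟩
  | succ t ih =>
    intro hs i hi1 hi2
    rcases Nat.lt_or_ge t s with hlt | hge
    · have : s = t + 1 := by omega
      subst this
      exact ⟨t + 1, le_rfl, le_rfl, by omega⟩
    rcases redPos_succ hf t with ⟨he, -⟩ | ⟨he, -⟩
    · rw [he] at hi2
      obtain ⟨r, hr1, hr2, hr3⟩ := ih hge i hi1 hi2
      exact ⟨r, hr1, by omega, hr3⟩
    · rw [he] at hi2
      rcases (show i ≤ t - cnt f t ∨ i = t - cnt f t + 1 by omega) with hi | hi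
      · obtain ⟨r, hr1, hr2, hr3⟩ := ih hge i hi1 hi
        exact ⟨r, hr1, by omega, hr3⟩
      · exact ⟨t + 1, by omega, le_rfl, by rw [he]; exact hi.symm⟩

/-- Consecutive sites of `flatWalk` are lattice neighbours. [cite: MadrasSlade1993, Definition 1.2.4] -/
theorem flatWalk_adj (hf : IsFlats n f) (hn : n = L + 4) (hR : IsRedWord A L R) (u : Steps d) {t : ℕ} (ht : t < n) :
    (zdGraph (d + 1)).Adj (flatWalk d n R f u t) (flatWalk d n R f u (t + 1)) := by
  have hmin : min t n = t := min_eq_left ht.le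
  have hmin' : min (t + 1) n = t + 1 := min_eq_left (by omega)
  rcases redPos_succ hf t with ⟨he, hmem⟩ | ⟨he, hmem⟩
  · -- transverse step number `cnt f t`
    have hc : cnt f (t + 1) = cnt f t + 1 := by rw [cnt_succ hf, if_pos hmem]
    have hc3 : cnt f t ≤ 3 := cnt_le_three_of_flat hf hmem
    have : flatWalk d n R f u (t + 1) = flatWalk d n R f u t + twoStepV d (nth d u (cnt f t)) := by
      rw [flatWalk, flatWalk, hmin, hmin', he, hc, psum4_succ d u hc3]; abel
    rw [this]; exact adj_add_twoStepV d _ _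
  · -- vertical step at reduced position `j = t − cnt f t < L`
    have hc : cnt f (t + 1) = cnt f t := by rw [cnt_succ hf, if_neg hmem]; rfl
    have hjL : t - cnt f t < L := by
      have := redPos_le hf hn (show t + 1 ≤ n by omega)
      omega
    rcases hR.step (t - cnt f t) hjL with hup | hdn
    · have : flatWalk d n R f u (t + 1) = flatWalk d n R f u t + Pi.single 0 1 := by
        rw [flatWalk, flatWalk, hmin, hmin', he, hc, hup, Nat.cast_add, Nat.cast_one, Pi.single_add]; abel
      rw [this]; exact adj_add_e0_tw d _
    · have : flatWalk d n R f u t = flatWalk d n R f u (t + 1) + Pi.single 0 1 := by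
        rw [flatWalk, flatWalk, hmin, hmin', he, hc, hdn, Nat.cast_add, Nat.cast_one, Pi.single_add]; abel
      rw [this]; exact (adj_add_e0_tw d _).symm

/-- `flatWalk` is a bridge of span `A`. [cite: MadrasSlade1993, §4.2, remark after Theorem 4.2.4 (p. 94)] -/
theorem flatWalk_isBridge (hf : IsFlats n f) (hn : n = L + 4) (hR : IsRedWord A L R) (u : Steps d) :
    IsBridge n (flatWalk d n R f u) := by
  intro i hi1 hi2
  rw [flatWalk_apply_zero, flatWalk_apply_zero, flatWalk_apply_zero, min_eq_left hi2, min_eq_left (Nat.zero_le _), min_self,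
    cnt_zero, Nat.sub_zero, hR.zero, cnt_eq_four hf le_rfl, show n - 4 = L by omega, hR.last]
  have hj1 : 1 ≤ i - cnt f i := by have := cnt_lt hf hi1; omega
  obtain ⟨h1', h2'⟩ := hR.range (i - cnt f i) hj1 (redPos_le hf hn hi2)
  exact ⟨by exact_mod_cast h1', by exact_mod_cast h2'⟩

/-- The heights of `flatWalk` at the times `≤ n` are the reduced word at the reduced positions. [cite: MadrasSlade1993, §4.2, remark after Theorem 4.2.4 (p. 94)] -/
theorem flatWalk_height (u : Steps d) {t : ℕ} (ht : t ≤ n) : flatWalk d n R f u t 0 = R (t - cnt f t) := by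
  rw [flatWalk_apply_zero, min_eq_left ht]

/-- `flatWalk` has no renewal time in `[1, n−1]`. [cite: DuminilCopinHammond2013, §2.2] -/
theorem flatWalk_not_renewal (hf : IsFlats n f) (hn : n = L + 4) (hR : IsRedWord A L R) (u : Steps d) {t : ℕ} (ht1 : 1 ≤ t)
    (htn : t ≤ n - 1) : ¬ IsRenewalTime n (flatWalk d n R f u) t := by
  rintro ⟨-, hb1, hb2⟩
  -- the two bridge conditions in terms of heights
  have hle : ∀ i, 1 ≤ i → i ≤ t → R (i - cnt f i) ≤ R (t - cnt f t) := by
    intro i hi1 hi2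
    have := (hb1 i hi1 hi2).2
    rw [flatWalk_height u (by omega), flatWalk_height u (by omega)] at this
    exact_mod_cast this
  have hgt : ∀ j, 1 ≤ j → j ≤ n - t → R (t - cnt f t) < R (t + j - cnt f (t + j)) := by
    intro j hj1 hj2
    have := (hb2 j hj1 hj2).1
    simp only [add_zero] at this
    rw [flatWalk_height u (by omega), flatWalk_height u (by omega)] at this
    exact_mod_cast this
  have hj1 : 1 ≤ t - cnt f t := by have := cnt_lt hf ht1; omega
  rcases (redPos_le hf hn (show t ≤ n by omega)).lt_or_eq with hjL | hjL
  · rcases hR.noRenewal (t - cnt f t) hj1 hjL with ⟨i, hij, hRi⟩ | ⟨i, hji, hiL, hRi⟩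
    · -- a higher site before: reduced position `i ≤ j(t)` is visited at a time `r ≤ t`
      obtain ⟨r, -, hrt, hr⟩ := exists_redPos_eq hf (s := 0) t (Nat.zero_le t) i (by rw [cnt_zero]; omega) hij
      have hr1 : 1 ≤ r := by
        by_contra h0
        have : r = 0 := by omega
        rw [this, cnt_zero, Nat.sub_zero] at hr
        rw [← hr, hR.zero] at hRi
        exact absurd hRi (by have := (hR.range _ hj1 hjL.le).1; omega)
      have := hle r hr1 hrt
      rw [hr] at this
      omega
    · -- a site not higher after: reduced position `i > j(t)` is visited at a time `r > t`
      have hjn : n - cnt f n = L := by rw [cnt_eq_four hf le_rfl]; omega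
      obtain ⟨r, htr, hrn, hr⟩ := exists_redPos_eq hf (s := t) n (by omega) i hji.le (by rw [hjn]; exact hiL)
      have hrt : t < r := by
        by_contra h0
        have : r = t := by omega
        rw [this] at hr; omega
      have := hgt (r - t) (by omega) (by omega)
      rw [show t + (r - t) = r by omega, hr] at this
      omega
  · -- `j(t) = L` with `t < n`: the next step is a flat, so the height does not increase
    have := hgt 1 le_rfl (by omega)
    have h2 := redPos_le hf hn (show t + 1 ≤ n by omega)
    rcases redPos_succ hf t with ⟨he, -⟩ | ⟨he, -⟩
    · rw [he] at this; omega
    · omega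

/-- Self-avoiding members of the family are irreducible bridges of span `A`, i.e. of cost `n − A`.
[cite: DuminilCopinHammond2013, §2.2] -/
theorem flatWalk_mem_filter (hf : IsFlats n f) (hn : n = L + 4) (hR : IsRedWord A L R) {u : Steps d}
    (hu : flatWalk d n R f u ∈ saws (d + 1) n) :
    flatWalk d n R f u ∈ (irreducibleBridges (d + 1) n).filter fun ω => costZd d n ω = n - A := by
  refine Finset.mem_filter.2 ⟨mem_irreducibleBridges.2 ⟨mem_bridges.2 ⟨hu, flatWalk_isBridge hf hn hR u⟩,
    ⟨by omega, flatWalk_isBridge hf hn hR u, fun k hk1 hk2 => flatWalk_not_renewal hf hn hR u hk1 hk2⟩⟩, ?_⟩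
  simp only [costZd, flatWalk_apply_zero, min_self, cnt_eq_four hf le_rfl, show n - 4 = L by omega, hR.last, Int.toNat_natCast]

/-- The flat times of `flatWalk` are exactly `a, b, c, e`. [cite: MadrasSlade1993, §4.2, remark after Theorem 4.2.4 (p. 94)] -/
theorem flatWalk_flat_iff (hf : IsFlats n f) (hn : n = L + 4) (hR : IsRedWord A L R) (u : Steps d) {t : ℕ} (ht : t < n) :
    flatWalk d n R f u (t + 1) 0 = flatWalk d n R f u t 0 ↔ (t = f.1 ∨ t = f.2.1 ∨ t = f.2.2.1 ∨ t = f.2.2.2) := by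
  rw [flatWalk_height u (by omega), flatWalk_height u ht.le]
  rcases redPos_succ hf t with ⟨he, hmem⟩ | ⟨he, hmem⟩
  · rw [he]; exact ⟨fun _ => hmem, fun _ => rfl⟩
  · rw [he]
    have hjL : t - cnt f t < L := by have := redPos_le hf hn (show t + 1 ≤ n by omega); omega
    constructor
    · intro h
      rcases hR.step _ hjL with h' | h'
      · rw [h'] at h; exact absurd h (by push_cast; linarith)
      · rw [h'] at h; exact absurd h (by push_cast; linarith)
    · intro h; exact absurd h hmem

/-- The transverse step taken at the `m`-th flat time is `u_{m+1}`. [cite: MadrasSlade1993, Definition 1.2.4] -/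
theorem flatWalk_step_at_flat (hf : IsFlats n f) (u : Steps d) {t : ℕ} (hmem : t = f.1 ∨ t = f.2.1 ∨ t = f.2.2.1 ∨ t = f.2.2.2) :
    flatWalk d n R f u (t + 1) = flatWalk d n R f u t + twoStepV d (nth d u (cnt f t)) := by
  have htn : t < n := by obtain ⟨h1, h2, h3, h4, h5⟩ := hf; rcases hmem with rfl | rfl | rfl | rfl <;> omega
  have hc : cnt f (t + 1) = cnt f t + 1 := by rw [cnt_succ hf, if_pos hmem]
  have hc3 : cnt f t ≤ 3 := cnt_le_three_of_flat hf hmem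
  rcases redPos_succ hf t with ⟨he, -⟩ | ⟨-, hmem'⟩
  · rw [flatWalk, flatWalk, min_eq_left htn.le, min_eq_left (by omega : t + 1 ≤ n), he, hc, psum4_succ d u hc3]; abel
  · exact absurd hmem hmem'

/-- `flatWalk d n R f` is injective in the transverse data. [cite: MadrasSlade1993, Definition 1.2.4] -/
theorem flatWalk_injective (hf : IsFlats n f) : Function.Injective (flatWalk d n R f) := by
  intro u u' h
  obtain ⟨c0, c1, c2, c3⟩ := cnt_at_flats hf
  have key : ∀ t, (t = f.1 ∨ t = f.2.1 ∨ t = f.2.2.1 ∨ t = f.2.2.2) → twoStepV d (nth d u (cnt f t)) = twoStepV d (nth d u' (cnt f t)) := by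
    intro t hmem
    have e1 := flatWalk_step_at_flat (R := R) hf u hmem
    have e2 := flatWalk_step_at_flat (R := R) hf u' hmem
    rw [h] at e1
    have := e1.symm.trans e2
    exact add_left_cancel this
  have k1 := key f.1 (Or.inl rfl); rw [c0] at k1
  have k2 := key f.2.1 (Or.inr (Or.inl rfl)); rw [c1] at k2
  have k3 := key f.2.2.1 (Or.inr (Or.inr (Or.inl rfl))); rw [c2] at k3
  have k4 := key f.2.2.2 (Or.inr (Or.inr (Or.inr rfl))); rw [c3] at k4
  obtain ⟨n0, n1, n2, n3⟩ := nth_vals d u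
  obtain ⟨m0, m1, m2, m3⟩ := nth_vals d u'
  rw [n0, m0] at k1; rw [n1, m1] at k2; rw [n2, m2] at k3; rw [n3, m3] at k4
  obtain ⟨u1, u2, u3, u4⟩ := u; obtain ⟨v1, v2, v3, v4⟩ := u'
  simp only at k1 k2 k3 k4
  rw [twoStepV_injective d k1, twoStepV_injective d k2, twoStepV_injective d k3, twoStepV_injective d k4]

end generic


section generic2

variable {d n A L : ℕ} {R R' : ℕ → ℕ} {f f' : ℕ × ℕ × ℕ × ℕ}

/-- Two members of table-driven families that coincide have the same flat times. [cite: MadrasSlade1993, §4.2, remark after Theorem 4.2.4 (p. 94)] -/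
theorem flats_eq_of_eq (hf : IsFlats n f) (hf' : IsFlats n f') (hn : n = L + 4) (hR : IsRedWord A L R) (hR' : IsRedWord A L R')
    {u u' : Steps d} (h : flatWalk d n R f u = flatWalk d n R' f' u') : f = f' := by
  have key : ∀ t, t < n → ((t = f.1 ∨ t = f.2.1 ∨ t = f.2.2.1 ∨ t = f.2.2.2) ↔ (t = f'.1 ∨ t = f'.2.1 ∨ t = f'.2.2.1 ∨ t = f'.2.2.2)) := by
    intro t ht
    rw [← flatWalk_flat_iff hf hn hR u ht, ← flatWalk_flat_iff hf' hn hR' u' ht, h]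
  obtain ⟨a, b, c, e⟩ := f
  obtain ⟨a', b', c', e'⟩ := f'
  obtain ⟨h1, h2, h3, h4, h5⟩ := hf
  obtain ⟨h1', h2', h3', h4', h5'⟩ := hf'
  simp only at h1 h2 h3 h4 h5 h1' h2' h3' h4' h5' key ⊢
  have ka := (key a (by omega)).1 (Or.inl rfl)
  have kb := (key b (by omega)).1 (Or.inr (Or.inl rfl))
  have kc := (key c (by omega)).1 (Or.inr (Or.inr (Or.inl rfl)))
  have ke := (key e (by omega)).1 (Or.inr (Or.inr (Or.inr rfl)))
  have ka' := (key a' (by omega)).2 (Or.inl rfl)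
  have kb' := (key b' (by omega)).2 (Or.inr (Or.inl rfl))
  have kc' := (key c' (by omega)).2 (Or.inr (Or.inr (Or.inl rfl)))
  have ke' := (key e' (by omega)).2 (Or.inr (Or.inr (Or.inr rfl)))
  simp only [Prod.mk.injEq]
  omega

/-- Two members that coincide have the same reduced word on `[0, L]`. [cite: MadrasSlade1993, §4.2, remark after Theorem 4.2.4 (p. 94)] -/
theorem word_eq_of_eq (hf : IsFlats n f) (hn : n = L + 4) {u u' : Steps d}
    (h : flatWalk d n R f u = flatWalk d n R' f u') {j : ℕ} (hj : j ≤ L) : R j = R' j := by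
  have hjn : n - cnt f n = L := by rw [cnt_eq_four hf le_rfl]; omega
  obtain ⟨r, -, hrn, hr⟩ := exists_redPos_eq hf (s := 0) n (Nat.zero_le n) j (by rw [cnt_zero]; omega) (by rw [hjn]; exact hj)
  have e1 := flatWalk_height (R := R) (f := f) u hrn
  have e2 := flatWalk_height (R := R') (f := f) u' hrn
  rw [h] at e1
  rw [hr] at e1 e2
  exact_mod_cast e1.symm.trans e2

end generic2

/-! ### The two reduced words are admissible -/

/-- The reduced staple word is admissible (`A ≥ 2`, `L = 3A − 2`). [cite: MadrasSlade1993, §4.2, remark after Theorem 4.2.4 (p. 94)] -/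
theorem isRedWord_stapleR {A : ℕ} (hA : 2 ≤ A) : IsRedWord A (3 * A - 2) (stapleR A) where
  zero := by simp [stapleR]
  step := fun j hj => by simp only [stapleR]; split_ifs <;> omega
  range := fun j hj1 hj2 => by simp only [stapleR]; split_ifs <;> omega
  last := by simp only [stapleR]; split_ifs <;> omega
  noRenewal := by
    intro j hj1 hjL
    by_cases h1 : j < A
    · right; refine ⟨2 * A - j, by omega, by omega, ?_⟩
      simp only [stapleR]; split_ifs <;> omega
    by_cases h2 : j = A
    · right; refine ⟨A + 1, by omega, by omega, ?_⟩
      simp only [stapleR]; split_ifs <;> omega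
    · left; refine ⟨A, by omega, ?_⟩
      simp only [stapleR]; split_ifs <;> omega

/-- The reduced bump words are admissible (`2 ≤ P ≤ A − 1`, `L = 3A − 2`). [cite: MadrasSlade1993, §4.2, remark after Theorem 4.2.4 (p. 94)] -/
theorem isRedWord_bumpR {A P : ℕ} (hP : 2 ≤ P) (hPA : P + 1 ≤ A) : IsRedWord A (3 * A - 2) (bumpR A P) where
  zero := by simp [bumpR]
  step := fun j hj => by simp only [bumpR]; split_ifs <;> omega
  range := fun j hj1 hj2 => by simp only [bumpR]; split_ifs <;> omega
  last := by simp only [bumpR]; split_ifs <;> omega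
  noRenewal := by
    intro j hj1 hjL
    by_cases h1 : j < P
    · right; refine ⟨2 * P - j, by omega, by omega, ?_⟩
      simp only [bumpR]; split_ifs <;> omega
    by_cases h2 : j = P
    · right; refine ⟨P + 1, by omega, by omega, ?_⟩
      simp only [bumpR]; split_ifs <;> omega
    by_cases h3 : j ≤ 2 * P - 1
    · left; refine ⟨P, by omega, ?_⟩
      simp only [bumpR]; split_ifs <;> omega
    by_cases h4 : j < 2 * P + A - 2
    · -- on the long ascent: compare with the first peak `P` or with the second valley `P`
      by_cases h5 : j + 2 - 2 * P < P
      · left; refine ⟨P, by omega, ?_⟩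
        simp only [bumpR]; split_ifs <;> omega
      · right; refine ⟨P + 2 * A - 2, by omega, by omega, ?_⟩
        simp only [bumpR]; split_ifs <;> omega
    by_cases h6 : j = 2 * P + A - 2
    · right; refine ⟨j + 1, by omega, by omega, ?_⟩
      simp only [bumpR]; split_ifs <;> omega
    · left; refine ⟨2 * P + A - 2, by omega, ?_⟩
      simp only [bumpR]; split_ifs <;> omega

/-- At the reduced position `P + 1` the two words differ (`P + 1` versus `P − 1`). [cite: MadrasSlade1993, §4.2, remark after Theorem 4.2.4 (p. 94)] -/
theorem stapleR_ne_bumpR {A P : ℕ} (hP : 2 ≤ P) (hPA : P + 1 ≤ A) : stapleR A (P + 1) ≠ bumpR A P (P + 1) := by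
  simp only [stapleR, bumpR]; split_ifs <;> omega

/-! ### The parameter sets and the fibres -/

/-- One of the four flats sits at the reduced position `A` (flat number `k` at time `A + k`). [cite: MadrasSlade1993, §4.2, remark after Theorem 4.2.4 (p. 94)] -/
def PinA (A : ℕ) (f : ℕ × ℕ × ℕ × ℕ) : Prop := f.1 = A ∨ f.2.1 = A + 1 ∨ f.2.2.1 = A + 2 ∨ f.2.2.2 = A + 3

/-- One of the four flats sits at the reduced position `2A − 1`. [cite: MadrasSlade1993, §4.2, remark after Theorem 4.2.4 (p. 94)] -/
def PinV (A : ℕ) (f : ℕ × ℕ × ℕ × ℕ) : Prop := f.1 = 2 * A - 1 ∨ f.2.1 = 2 * A ∨ f.2.2.1 = 2 * A + 1 ∨ f.2.2.2 = 2 * A + 2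

/-- `PinA` is decidable. [cite: MadrasSlade1993, §4.2, remark after Theorem 4.2.4 (p. 94)] -/
instance (A : ℕ) : DecidablePred (PinA A) := fun f => by unfold PinA; infer_instance

/-- `PinV` is decidable. [cite: MadrasSlade1993, §4.2, remark after Theorem 4.2.4 (p. 94)] -/
instance (A : ℕ) : DecidablePred (PinV A) := fun f => by unfold PinV; infer_instance

/-- The flat-time tuples of regime (i): `1 ≤ a < b < c < e < 3A + 2` with the two turn plateaus pinned at the reduced positions `A`, `2A − 1`.
[cite: MadrasSlade1993, §4.2, remark after Theorem 4.2.4 (p. 94)] -/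
def stapleFlats (A : ℕ) : Finset (ℕ × ℕ × ℕ × ℕ) :=
  (range (3 * A + 2) ×ˢ (range (3 * A + 2) ×ˢ (range (3 * A + 2) ×ˢ range (3 * A + 2)))).filter
    fun f => IsFlats (3 * A + 2) f ∧ PinA A f ∧ PinV A f

/-- Membership in `stapleFlats`. [cite: MadrasSlade1993, §4.2, remark after Theorem 4.2.4 (p. 94)] -/
theorem mem_stapleFlats {A : ℕ} {f : ℕ × ℕ × ℕ × ℕ} : f ∈ stapleFlats A ↔ IsFlats (3 * A + 2) f ∧ PinA A f ∧ PinV A f := by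
  constructor
  · intro h; exact (Finset.mem_filter.1 h).2
  · intro h
    refine Finset.mem_filter.2 ⟨?_, h⟩
    obtain ⟨h1, h2, h3, h4, h5⟩ := h.1
    simp only [Finset.mem_product, Finset.mem_range]
    omega

/-- The flat times of the bump word with first peak `P`: `(P, 2P, 2P + A, P + 2A + 1)`. [cite: MadrasSlade1993, §4.2, remark after Theorem 4.2.4 (p. 94)] -/
def bumpF (A P : ℕ) : ℕ × ℕ × ℕ × ℕ := (P, 2 * P, 2 * P + A, P + 2 * A + 1)

/-- `bumpF A P` is an admissible flat-time tuple. [cite: MadrasSlade1993, §4.2, remark after Theorem 4.2.4 (p. 94)] -/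
theorem isFlats_bumpF {A P : ℕ} (hP : 2 ≤ P) (hPA : P + 1 ≤ A) : IsFlats (3 * A + 2) (bumpF A P) := by
  simp only [IsFlats, bumpF]; omega

open Classical in
/-- The fibre of a regime-(i) height word: the transverse 4-tuples for which the staple walk with flats `f` is self-avoiding.
[cite: MadrasSlade1993, §4.2, remark after Theorem 4.2.4 (p. 94)] -/
def admS (d A : ℕ) (f : ℕ × ℕ × ℕ × ℕ) : Finset (Steps d) :=
  Finset.univ.filter fun u => flatWalk d (3 * A + 2) (stapleR A) f u ∈ saws (d + 1) (3 * A + 2)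

open Classical in
/-- The fibre of a regime-(ii) height word. [cite: MadrasSlade1993, §4.2, remark after Theorem 4.2.4 (p. 94)] -/
def admB (d A P : ℕ) : Finset (Steps d) :=
  Finset.univ.filter fun u => flatWalk d (3 * A + 2) (bumpR A P) (bumpF A P) u ∈ saws (d + 1) (3 * A + 2)

/-- Membership in `admS`. [cite: MadrasSlade1993, §4.2, remark after Theorem 4.2.4 (p. 94)] -/
theorem mem_admS {d A : ℕ} {f : ℕ × ℕ × ℕ × ℕ} {u : Steps d} :
    u ∈ admS d A f ↔ flatWalk d (3 * A + 2) (stapleR A) f u ∈ saws (d + 1) (3 * A + 2) := by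
  classical
  simp [admS]

/-- Membership in `admB`. [cite: MadrasSlade1993, §4.2, remark after Theorem 4.2.4 (p. 94)] -/
theorem mem_admB {d A P : ℕ} {u : Steps d} :
    u ∈ admB d A P ↔ flatWalk d (3 * A + 2) (bumpR A P) (bumpF A P) u ∈ saws (d + 1) (3 * A + 2) := by
  classical
  simp [admB]

/-! ### The families lie in the layer and are pairwise disjoint -/

/-- Regime-(i) members are cost-`(2A+2)` irreducible bridges of length `3A + 2`. [cite: DuminilCopinHammond2013, §2.2] -/
theorem staple_mem_layer (d : ℕ) {A : ℕ} (hA : 2 ≤ A) {f} (hf : f ∈ stapleFlats A) {u : Steps d} (hu : u ∈ admS d A f) :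
    flatWalk d (3 * A + 2) (stapleR A) f u ∈ (irreducibleBridges (d + 1) (3 * A + 2)).filter fun ω => costZd d (3 * A + 2) ω = 2 * A + 2 := by
  have h := flatWalk_mem_filter (mem_stapleFlats.1 hf).1 (show 3 * A + 2 = (3 * A - 2) + 4 by omega) (isRedWord_stapleR hA) (mem_admS.1 hu)
  rwa [show 3 * A + 2 - A = 2 * A + 2 by omega] at h

/-- Regime-(ii) members are cost-`(2A+2)` irreducible bridges of length `3A + 2`. [cite: DuminilCopinHammond2013, §2.2] -/
theorem bump_mem_layer (d : ℕ) {A P : ℕ} (hP : 2 ≤ P) (hPA : P + 1 ≤ A) {u : Steps d} (hu : u ∈ admB d A P) :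
    flatWalk d (3 * A + 2) (bumpR A P) (bumpF A P) u ∈
      (irreducibleBridges (d + 1) (3 * A + 2)).filter fun ω => costZd d (3 * A + 2) ω = 2 * A + 2 := by
  have h := flatWalk_mem_filter (isFlats_bumpF hP hPA) (show 3 * A + 2 = (3 * A - 2) + 4 by omega) (isRedWord_bumpR hP hPA) (mem_admB.1 hu)
  rwa [show 3 * A + 2 - A = 2 * A + 2 by omega] at h


/-! ### The converse: every member of the layer belongs to one of the families -/

/-- A four-element set of naturals, sorted. [folklore] -/
private theorem exists_sorted_four (F : Finset ℕ) (h : F.card = 4) : ∃ a b c e : ℕ, a < b ∧ b < c ∧ c < e ∧ F = {a, b, c, e} := by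
  classical
  set g := F.orderEmbOfFin h with hg
  refine ⟨g 0, g 1, g 2, g 3, g.strictMono (by decide), g.strictMono (by decide), g.strictMono (by decide), ?_⟩
  apply Finset.Subset.antisymm
  · intro x hx
    have hx' : x ∈ Set.range g := by rw [hg, Finset.range_orderEmbOfFin]; exact hx
    obtain ⟨i, rfl⟩ := hx'
    fin_cases i <;> simp
  · intro x hx
    simp only [Finset.mem_insert, Finset.mem_singleton] at hx
    rcases hx with rfl | rfl | rfl | rfl <;> exact Finset.orderEmbOfFin_mem F h _

/-- One more time step adds the indicator of a flat (ℕ form). [folklore] -/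
private theorem card_filter_lt_succ_nat (F : Finset ℕ) (t : ℕ) :
    (F.filter (· < t + 1)).card = (F.filter (· < t)).card + if t ∈ F then 1 else 0 := by
  classical
  have hsplit : F.filter (· < t + 1) = F.filter (· < t) ∪ F.filter (· = t) := by
    ext x; simp only [Finset.mem_filter, Finset.mem_union]
    constructor
    · rintro ⟨hx, hlt⟩
      by_cases hxt : x = t
      · exact Or.inr ⟨hx, hxt⟩
      · exact Or.inl ⟨hx, by omega⟩
    · rintro (⟨hx, hlt⟩ | ⟨hx, hxt⟩)
      · exact ⟨hx, by omega⟩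
      · exact ⟨hx, by omega⟩
  have hdisj : Disjoint (F.filter (· < t)) (F.filter (· = t)) := by
    rw [Finset.disjoint_left]; intro x hx hx'
    simp only [Finset.mem_filter] at hx hx'
    have h1 := hx.2; have h2 := hx'.2; omega
  rw [hsplit, Finset.card_union_of_disjoint hdisj, Finset.filter_eq' F t]
  by_cases ht : t ∈ F
  · rw [if_pos ht, if_pos ht, Finset.card_singleton]
  · rw [if_neg ht, if_neg ht, Finset.card_empty]

/-- The flats of `{a, b, c, e}` before `t` are counted by `cnt (a, b, c, e) t`. [folklore] -/
private theorem card_filter_lt_eq_cnt {n a b c e : ℕ} (hf : IsFlats n (a, b, c, e)) (t : ℕ) :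
    (({a, b, c, e} : Finset ℕ).filter (· < t)).card = cnt (a, b, c, e) t := by
  classical
  induction t with
  | zero => rw [cnt_zero]; simp
  | succ t ih =>
    rw [card_filter_lt_succ_nat, ih, cnt_succ hf t]
    simp only [Finset.mem_insert, Finset.mem_singleton]

section converse

variable {d n A L : ℕ} {R : ℕ → ℕ} {f : ℕ × ℕ × ℕ × ℕ}

/-- A vertical step of `flatWalk`. [cite: MadrasSlade1993, Definition 1.2.4] -/
theorem flatWalk_succ_of_not_flat (hf : IsFlats n f) (hn : n = L + 4) (hR : IsRedWord A L R) (u : Steps d) {t : ℕ} (ht : t < n)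
    (hmem : ¬ (t = f.1 ∨ t = f.2.1 ∨ t = f.2.2.1 ∨ t = f.2.2.2)) :
    (flatWalk d n R f u (t + 1) = flatWalk d n R f u t + Pi.single 0 1 ∧ (R (t + 1 - cnt f (t + 1)) : ℤ) = R (t - cnt f t) + 1) ∨
    (flatWalk d n R f u (t + 1) = flatWalk d n R f u t - Pi.single 0 1 ∧ (R (t + 1 - cnt f (t + 1)) : ℤ) = R (t - cnt f t) - 1) := by
  have hmin : min t n = t := min_eq_left ht.le
  have hmin' : min (t + 1) n = t + 1 := min_eq_left (by omega)
  have hc : cnt f (t + 1) = cnt f t := by rw [cnt_succ hf, if_neg hmem]; rfl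
  rcases redPos_succ hf t with ⟨-, hmem'⟩ | ⟨he, -⟩
  · exact absurd hmem' hmem
  have hjL : t - cnt f t < L := by have := redPos_le hf hn (show t + 1 ≤ n by omega); omega
  rcases hR.step (t - cnt f t) hjL with hup | hdn
  · left
    refine ⟨?_, by rw [he, hup]; push_cast; ring⟩
    rw [flatWalk, flatWalk, hmin, hmin', he, hc, hup, Nat.cast_add, Nat.cast_one, Pi.single_add]; abel
  · right
    refine ⟨?_, by rw [he, hdn]; push_cast; ring⟩
    rw [flatWalk, flatWalk, hmin, hmin', he, hc, hdn, Nat.cast_add, Nat.cast_one, Pi.single_add]; abel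

/-- A self-avoiding walk whose heights are `R` at the reduced positions of the flats `f` is `flatWalk d n R f u` for the transverse
steps `u` it takes at the four flat times. [cite: MadrasSlade1993, §4.2, remark after Theorem 4.2.4 (p. 94)] -/
theorem exists_eq_flatWalk_of_heights (hf : IsFlats n f) (hn : n = L + 4) (hR : IsRedWord A L R) {ω : ℕ → Site (d + 1)}
    (hω : ω ∈ saws (d + 1) n) (hH : ∀ t, t ≤ n → ω t 0 = R (t - cnt f t)) : ∃ u : Steps d, ω = flatWalk d n R f u := by
  obtain ⟨h0, hend, hadj, -⟩ := mem_saws.1 hω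
  obtain ⟨h1, h2, h3, h4, h5⟩ := hf
  -- the height is constant across each flat time
  have hflatH : ∀ t, (t = f.1 ∨ t = f.2.1 ∨ t = f.2.2.1 ∨ t = f.2.2.2) → ω (t + 1) 0 = ω t 0 := by
    intro t hmem
    have htn : t < n := by rcases hmem with rfl | rfl | rfl | rfl <;> omega
    rcases redPos_succ ⟨h1, h2, h3, h4, h5⟩ t with ⟨he, -⟩ | ⟨-, hmem'⟩
    · rw [hH (t + 1) (by omega), hH t htn.le, he]
    · exact absurd hmem hmem'
  obtain ⟨u1, hu1⟩ := exists_twoStepV_of_adj d (hadj f.1 (by omega)) (hflatH f.1 (Or.inl rfl))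
  obtain ⟨u2, hu2⟩ := exists_twoStepV_of_adj d (hadj f.2.1 (by omega)) (hflatH f.2.1 (Or.inr (Or.inl rfl)))
  obtain ⟨u3, hu3⟩ := exists_twoStepV_of_adj d (hadj f.2.2.1 (by omega)) (hflatH f.2.2.1 (Or.inr (Or.inr (Or.inl rfl))))
  obtain ⟨u4, hu4⟩ := exists_twoStepV_of_adj d (hadj f.2.2.2 (by omega)) (hflatH f.2.2.2 (Or.inr (Or.inr (Or.inr rfl))))
  set u : Steps d := (u1, u2, u3, u4) with hu
  have hf' : IsFlats n f := ⟨h1, h2, h3, h4, h5⟩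
  obtain ⟨c0, c1, c2, c3⟩ := cnt_at_flats hf'
  obtain ⟨n0, n1, n2, n3⟩ := nth_vals d u
  have main : ∀ t, t ≤ n → ω t = flatWalk d n R f u t := by
    intro t
    induction t with
    | zero =>
      intro _
      rw [h0, flatWalk, Nat.zero_min, cnt_zero, Nat.sub_zero, hR.zero]; simp [psum4]
    | succ t ih =>
      intro ht
      have prev := ih (by omega)
      by_cases hmem : t = f.1 ∨ t = f.2.1 ∨ t = f.2.2.1 ∨ t = f.2.2.2
      · rw [flatWalk_step_at_flat hf' u hmem, ← prev]
        rcases hmem with rfl | rfl | rfl | rfl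
        · rw [hu1, c0, n0]
        · rw [hu2, c1, n1]
        · rw [hu3, c2, n2]
        · rw [hu4, c3, n3]
      · rcases flatWalk_succ_of_not_flat hf' hn hR u (show t < n by omega) hmem with ⟨hw, hRj⟩ | ⟨hw, hRj⟩
        · have hup : ω (t + 1) 0 = ω t 0 + 1 := by rw [hH (t + 1) ht, hH t (by omega), hRj]
          rw [eq_add_e0_of_adj d (hadj t (by omega)) hup, prev, hw]
        · have hdn : ω (t + 1) 0 = ω t 0 - 1 := by rw [hH (t + 1) ht, hH t (by omega), hRj]
          rw [eq_sub_e0_of_adj d (hadj t (by omega)) hdn, prev, hw]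
  refine ⟨u, funext fun t => ?_⟩
  rcases Nat.lt_or_ge t (n + 1) with ht | ht
  · exact main t (by omega)
  · rw [hend t (by omega), flatWalk_of_le d n R f u (show n ≤ t by omega), main n le_rfl]

end converse

/-- ★ **Every cost-`(2A+2)` irreducible bridge of `ℤ^{d+1}` of length `3A + 2` (`A ≥ 2`) is a member of one of the two families**
(the two-slack structure theorem, then the transverse steps). [cite: MadrasSlade1993, §4.2, remark after Theorem 4.2.4 (p. 94)] -/
theorem exists_params_of_mem (d : ℕ) {A : ℕ} (hA : 2 ≤ A) {ω : ℕ → Site (d + 1)}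
    (hω : ω ∈ (irreducibleBridges (d + 1) (3 * A + 2)).filter fun ω => costZd d (3 * A + 2) ω = 2 * A + 2) :
    (∃ f ∈ stapleFlats A, ∃ u ∈ admS d A f, flatWalk d (3 * A + 2) (stapleR A) f u = ω) ∨
    (∃ P, 2 ≤ P ∧ P + 1 ≤ A ∧ ∃ u ∈ admB d A P, flatWalk d (3 * A + 2) (bumpR A P) (bumpF A P) u = ω) := by
  classical
  obtain ⟨hirr, hcost⟩ := Finset.mem_filter.1 hω
  obtain ⟨hbr, -⟩ := mem_irreducibleBridges.1 hirr
  obtain ⟨hωs, hb⟩ := mem_bridges.1 hbr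
  obtain ⟨h0, -, hadj, -⟩ := mem_saws.1 hωs
  have hspan : ω (3 * A + 2) 0 = A := by
    simp only [costZd] at hcost
    have := (span_le_and_cost_bound_zd hirr).1
    have hpos : 0 < ω (3 * A + 2) 0 := by have := (hb (3 * A + 2) (by omega) le_rfl).1; rwa [h0] at this
    omega
  obtain ⟨hF4, hcases⟩ := heights_of_length_eq_three_mul_span_add_two d hirr hA hspan rfl
  set F := flatTimes (3 * A + 2) ω with hF
  obtain ⟨a, b, c, e, hab, hbc, hce, hFeq⟩ := exists_sorted_four F hF4
  have hmemF : ∀ {t : ℕ}, t ∈ F ↔ t < 3 * A + 2 ∧ ω (t + 1) 0 = ω t 0 := by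
    intro t; simp only [hF, flatTimes, Finset.mem_filter, Finset.mem_range]
  have h1 : ω 1 0 = 1 := by
    have hb1 := (hb 1 le_rfl (by omega)).1
    rw [h0] at hb1
    have hs := abs_sub_le_one_of_adj (hadj 0 (by omega)) 0
    rw [h0, zero_add, abs_le] at hs
    simp only [Pi.zero_apply, sub_zero] at hs hb1
    omega
  have ha1 : 1 ≤ a := by
    by_contra ha0
    have : (0 : ℕ) ∈ F := by rw [hFeq]; simp only [Finset.mem_insert]; left; omega
    have := (hmemF.1 this).2
    rw [zero_add, h1, h0] at this
    exact absurd this (by simp)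
  have hen : e < 3 * A + 2 := (hmemF.1 (by rw [hFeq]; simp)).1
  have hfl : IsFlats (3 * A + 2) (a, b, c, e) := ⟨ha1, hab, hbc, hce, hen⟩
  have hcnt : ∀ t, (F.filter (· < t)).card = cnt (a, b, c, e) t := fun t => by rw [hFeq]; exact card_filter_lt_eq_cnt hfl t
  obtain ⟨c0, c1, c2, c3⟩ := cnt_at_flats hfl
  simp only at c0 c1 c2 c3
  rcases hcases with ⟨hword, ⟨τ, hτF, hτ⟩, ⟨τ', hτ'F, hτ'⟩⟩ | ⟨P, hP2, hPA, hFP, hword⟩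
  · -- regime (i)
    left
    have hpinA : PinA A (a, b, c, e) := by
      rw [hcnt τ] at hτ
      rw [hFeq] at hτF
      simp only [Finset.mem_insert, Finset.mem_singleton] at hτF
      simp only [PinA]
      rcases hτF with rfl | rfl | rfl | rfl
      · rw [c0] at hτ; left; push_cast at hτ; omega
      · rw [c1] at hτ; right; left; push_cast at hτ; omega
      · rw [c2] at hτ; right; right; left; push_cast at hτ; omega
      · rw [c3] at hτ; right; right; right; push_cast at hτ; omega
    have hpinV : PinV A (a, b, c, e) := by
      rw [hcnt τ'] at hτ'
      rw [hFeq] at hτ'F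
      simp only [Finset.mem_insert, Finset.mem_singleton] at hτ'F
      simp only [PinV]
      have hA1 : (1 : ℤ) ≤ A := by exact_mod_cast (by omega : 1 ≤ A)
      rcases hτ'F with rfl | rfl | rfl | rfl
      · rw [c0] at hτ'; left; push_cast at hτ'; omega
      · rw [c1] at hτ'; right; left; push_cast at hτ'; omega
      · rw [c2] at hτ'; right; right; left; push_cast at hτ'; omega
      · rw [c3] at hτ'; right; right; right; push_cast at hτ'; omega
    have hf : (a, b, c, e) ∈ stapleFlats A := mem_stapleFlats.2 ⟨hfl, hpinA, hpinV⟩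
    have hH : ∀ t, t ≤ 3 * A + 2 → ω t 0 = stapleR A (t - cnt (a, b, c, e) t) := fun t ht => by rw [hword t ht, hcnt t]
    obtain ⟨u, hu⟩ := exists_eq_flatWalk_of_heights hfl (show 3 * A + 2 = (3 * A - 2) + 4 by omega) (isRedWord_stapleR hA) hωs hH
    exact ⟨(a, b, c, e), hf, u, mem_admS.2 (hu ▸ hωs), hu.symm⟩
  · -- regime (ii)
    right
    have hfl' : IsFlats (3 * A + 2) (bumpF A P) := isFlats_bumpF hP2 hPA
    have hcnt' : ∀ t, (F.filter (· < t)).card = cnt (bumpF A P) t := fun t => by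
      rw [hFP]; exact card_filter_lt_eq_cnt (a := P) (b := 2 * P) (c := 2 * P + A) (e := P + 2 * A + 1) hfl' t
    have hH : ∀ t, t ≤ 3 * A + 2 → ω t 0 = bumpR A P (t - cnt (bumpF A P) t) := fun t ht => by rw [hword t ht, hcnt' t]
    obtain ⟨u, hu⟩ := exists_eq_flatWalk_of_heights hfl' (show 3 * A + 2 = (3 * A - 2) + 4 by omega) (isRedWord_bumpR hP2 hPA) hωs hH
    exact ⟨P, hP2, hPA, u, mem_admB.2 (hu ▸ hωs), hu.symm⟩

/-! ### The count -/

/-- ★ The layer is the disjoint union of the two families. [cite: MadrasSlade1993, §4.2, remark after Theorem 4.2.4 (p. 94)] -/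
theorem layer_eq_union (d : ℕ) {A : ℕ} (hA : 2 ≤ A) [DecidableEq (ℕ → Site (d + 1))] :
    ((irreducibleBridges (d + 1) (3 * A + 2)).filter fun ω => costZd d (3 * A + 2) ω = 2 * A + 2) =
      (stapleFlats A).biUnion (fun f => (admS d A f).image (flatWalk d (3 * A + 2) (stapleR A) f)) ∪
      (Finset.Icc 2 (A - 1)).biUnion (fun P => (admB d A P).image (flatWalk d (3 * A + 2) (bumpR A P) (bumpF A P))) := by
  ext ω
  simp only [Finset.mem_union, Finset.mem_biUnion, Finset.mem_image, Finset.mem_Icc]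
  constructor
  · intro h
    rcases exists_params_of_mem d hA h with ⟨f, hf, u, hu, rfl⟩ | ⟨P, hP2, hPA, u, hu, rfl⟩
    · exact Or.inl ⟨f, hf, u, hu, rfl⟩
    · exact Or.inr ⟨P, ⟨hP2, by omega⟩, u, hu, rfl⟩
  · rintro (⟨f, hf, u, hu, rfl⟩ | ⟨P, ⟨hP2, hPA⟩, u, hu, rfl⟩)
    · exact staple_mem_layer d hA hf hu
    · exact bump_mem_layer d hP2 (by omega) hu

/-- ★★ **The two-slack layer as a sum of fibres**: `N_{2A+2,3A+2}(ℤ^{d+1}) = Σ_{f ∈ stapleFlats A} #admS(f) + Σ_{P=2}^{A−1} #admB(P)`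
(`A ≥ 2`): the count of the layer is reduced to the numbers of admissible transverse 4-tuples per height word.
[cite: MadrasSlade1993, §4.2, remark after Theorem 4.2.4 (p. 94)] -/
theorem costCoeffZd_two_mul_add_two_eq_sum (d : ℕ) {A : ℕ} (hA : 2 ≤ A) :
    costCoeffZd d (2 * A + 2) (3 * A + 2) =
      ∑ f ∈ stapleFlats A, (admS d A f).card + ∑ P ∈ Finset.Icc 2 (A - 1), (admB d A P).card := by
  classical
  have hn : 3 * A + 2 = (3 * A - 2) + 4 := by omega
  rw [costCoeffZd, layer_eq_union d hA, Finset.card_union_of_disjoint, Finset.card_biUnion, Finset.card_biUnion]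
  · congr 1
    · exact Finset.sum_congr rfl fun f hf => Finset.card_image_of_injective _ (flatWalk_injective (mem_stapleFlats.1 hf).1)
    · exact Finset.sum_congr rfl fun P hP => Finset.card_image_of_injective _
        (flatWalk_injective (isFlats_bumpF (Finset.mem_Icc.1 hP).1 (by have := (Finset.mem_Icc.1 hP).2; omega)))
  · intro P hP P' hP' hne
    simp only [Function.onFun]
    rw [Finset.disjoint_left]
    intro ω hω hω'
    obtain ⟨u, -, rfl⟩ := Finset.mem_image.1 hω
    obtain ⟨u', -, h'⟩ := Finset.mem_image.1 hω'
    have hP1 := Finset.mem_Icc.1 (Finset.mem_coe.1 hP); have hP1' := Finset.mem_Icc.1 (Finset.mem_coe.1 hP')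
    have := flats_eq_of_eq (isFlats_bumpF hP1'.1 (by omega)) (isFlats_bumpF hP1.1 (by omega)) hn
      (isRedWord_bumpR hP1'.1 (by omega)) (isRedWord_bumpR hP1.1 (by omega)) h'
    simp only [bumpF, Prod.mk.injEq] at this
    exact hne this.1.symm
  · intro f hf f' hf' hne
    simp only [Function.onFun]
    rw [Finset.disjoint_left]
    intro ω hω hω'
    obtain ⟨u, -, rfl⟩ := Finset.mem_image.1 hω
    obtain ⟨u', -, h'⟩ := Finset.mem_image.1 hω'
    have hf1 := (mem_stapleFlats.1 (Finset.mem_coe.1 hf)).1; have hf1' := (mem_stapleFlats.1 (Finset.mem_coe.1 hf')).1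
    exact hne (flats_eq_of_eq hf1' hf1 hn (isRedWord_stapleR hA) (isRedWord_stapleR hA) h').symm
  · rw [Finset.disjoint_left]
    intro ω hω hω'
    obtain ⟨f, hf, hω⟩ := Finset.mem_biUnion.1 hω
    obtain ⟨u, -, rfl⟩ := Finset.mem_image.1 hω
    obtain ⟨P, hP, hω'⟩ := Finset.mem_biUnion.1 hω'
    obtain ⟨u', -, h'⟩ := Finset.mem_image.1 hω'
    have hP1 := Finset.mem_Icc.1 hP
    have hf1 := (mem_stapleFlats.1 hf).1
    have hfeq := flats_eq_of_eq hf1 (isFlats_bumpF hP1.1 (by omega)) hn (isRedWord_stapleR hA) (isRedWord_bumpR hP1.1 (by omega)) h'.symm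
    rw [hfeq] at h'
    have := word_eq_of_eq (R := bumpR A P) (R' := stapleR A) (isFlats_bumpF hP1.1 (by omega)) hn h' (j := P + 1) (by omega)
    exact stapleR_ne_bumpR hP1.1 (by omega) this.symm

end TwoSlack

end Literature.Probability.RandomPlanarGeometry.SAW.Zd

end
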